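import Literature.MathematicalPhysics.QuantumFieldTheory.Balaban1983to89.B10Eq32AxialSuN
import Literature.MathematicalPhysics.QuantumFieldTheory.Balaban1983to89.B7BlockAvgLog
import Literature.MathematicalPhysics.QuantumFieldTheory.Balaban1983to89.B7Eq84Concrete
import Literature.MathematicalPhysics.QuantumFieldTheory.Balaban1983to89.T4TermwiseTorus
import HarnessLib

/-!
# Route `UnitScaleTilt`, crux K1 child «MinimiserStabilityRegPr» (stmt-QuantumFields-19200), registered stub `stub_prop7From14` (skeleton birth_v7
# cc37a178…; leaf V3) — THE WITNESS AGAINST THE LQB LAW `Orbit16`, `ℤᵈ` PART: an `SU(2)` element `g = e^{X} ≠ 1` near `1` and the two-point bump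
# `u = g` on `Nℤᵈ`, `g⁻¹` on `e_{i₀} + Nℤᵈ`, `1` elsewhere, ALL of whose block averages (78)–(80) of [Balaban1985Averaging] are trivial

Cell `ym3-torus` ∕ fleet seat `ym-ust-19200-p1` (gen 8; HUMAN RULING D-0037, YM ladder rung R3).  WHY.  Companion of `UnitScaleTiltProp7Orbit16Unsat`
(the T³ statement `¬ T3SectALandauChart.Orbit16 S` for print's presentation): the restriction (1.29) of [Balaban1985RegularSpaces] constrains block
AVERAGES of a gauge transformation, not its values at the centres ([Balaban1985RegularSpaces] p. 80 «they do not agree with the group structure»); this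
file exhibits a restricted transformation that is `e^{X} ≠ 1` at a centre.  Over the block at a corner of `Nℤᵈ` the exponents `log(u(Lz)⁻¹u(x))` of (78)
are `0` (corner), `−2X` (the neighbour `+e_{i₀}`) and `−X` (the other `Lᵈ − 2` points), summing to `−LᵈX`, so `{u}_{B} = e^{X}e^{−X} = 1`; every other
block sees `u ≡ 1`; the higher averages (79)–(80) of the constant `1` are `1`.

WHAT IS PROVED (sorry-free, no definition).  §1 the element `S = diag(i, −i)`: `star_S`, `trace_S`, `S_ne_zero`, `S_mem_unitary`, `norm_smul_S`.
§2 `ℤᵈ`: `boxVec_nonneg_lt`, `boxVec_eq_zero_of_dvd`, `boxVec_eq_e_of_dvd`, `not_special_of_not_dvd`, **`savg_bump_eq_one`**,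
**`uavg_bump_eq_one`** (hypotheses: `2 ≤ L ≤ N`, `L ∣ N`, `‖X‖ ≤ 1/8`; the bump described by its three value clauses).

HONEST SCOPE.  Elementary algebra with the tree's series logarithm (`B7BlockAvgLog.mlog_exp`, radius `log 2`); helper toward stmt-QuantumFields-19200
(`--supports`), not a proof or refutation of the stub.

References: T. Bałaban, CMP 98 (1985) 17–51 [Balaban1985Averaging] ((78)–(80) p.30); CMP 99 (1985) 75–102 [Balaban1985RegularSpaces] ((1.29) p.81, p.80).
-/

noncomputable section

namespace Summit.QuantumFields.YangMills.Theorems.Prop7Orbit16UnsatZd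

open Literature.MathematicalPhysics.QuantumFieldTheory.Balaban1983to89
open B7Prop1Explicit renaming Site → LSite
open B7Prop1Explicit (e e_apply boxVec expUnit val_expUnit val_inv_expUnit)
open T4TermwiseTorus (boxVec_injective)

/-! ## §1 The witness element `g = exp X ∈ SU(2)`, `X = t·diag(i, −i)`, `g ≠ 1`, `‖X‖` small -/

section Element

open scoped Matrix.Norms.L2Operator

/-- The generator `S = diag(i, −i) ∈ 𝔰𝔲(2)`. [folklore] -/
theorem star_S : star (!![Complex.I, 0; 0, -Complex.I] : Matrix (Fin 2) (Fin 2) ℂ) = -!![Complex.I, 0; 0, -Complex.I] := by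
  ext i j
  fin_cases i <;> fin_cases j <;> simp [Matrix.star_apply]

/-- `tr S = 0`. [folklore] -/
theorem trace_S : Matrix.trace (!![Complex.I, 0; 0, -Complex.I] : Matrix (Fin 2) (Fin 2) ℂ) = 0 := by
  simp [Matrix.trace_fin_two]

/-- `S ≠ 0`. [folklore] -/
theorem S_ne_zero : (!![Complex.I, 0; 0, -Complex.I] : Matrix (Fin 2) (Fin 2) ℂ) ≠ 0 := by
  intro h
  have := congrFun (congrFun h 0) 0
  simp at this

/-- `S` is unitary (`S⋆S = SS⋆ = 1`), hence `‖S‖ = 1` in the C⋆-norm. [folklore] -/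
theorem S_mem_unitary : (!![Complex.I, 0; 0, -Complex.I] : Matrix (Fin 2) (Fin 2) ℂ) ∈ unitary (Matrix (Fin 2) (Fin 2) ℂ) := by
  rw [Unitary.mem_iff, star_S]
  constructor <;> (ext i j; fin_cases i <;> fin_cases j <;> simp [Matrix.mul_apply, Fin.sum_univ_two])

/-- `‖t·S‖ = |t|` (C⋆-norm of a unitary is `1`). [folklore] -/
theorem norm_smul_S (t : ℝ) : ‖((t : ℂ) • !![Complex.I, 0; 0, -Complex.I] : Matrix (Fin 2) (Fin 2) ℂ)‖ = |t| := by
  letI : CStarAlgebra (Matrix (Fin 2) (Fin 2) ℂ) := B10Eq29TubeLine.cstarAlgebraMatrix 2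
  rw [norm_smul, CStarRing.norm_of_mem_unitary S_mem_unitary, mul_one, Complex.norm_real, Real.norm_eq_abs]

end Element

/-! ## §2 On `ℤᵈ`: the block averages (78) of the two-point bump are trivial -/

section Bump

open NormedSpace
open B7Eq99Concrete (Sexp savg savg_apply Sexp_apply savg_const)
open B7Eq84Concrete (uavg uavg_succ_one_left uavg_zero)
open MatrixLog (mlog mlog_one)

variable {d : ℕ}

/-- Coordinates of `boxVec`: `0 ≤ (boxVec L r)_i < L`. [folklore] -/
theorem boxVec_nonneg_lt {L : ℕ} (r : Fin d → Fin L) (i : Fin d) : (0 : ℤ) ≤ boxVec L r i ∧ boxVec L r i < (L : ℤ) := by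
  constructor
  · show (0 : ℤ) ≤ ((r i : ℕ) : ℤ); positivity
  · show ((r i : ℕ) : ℤ) < (L : ℤ); exact_mod_cast (r i).isLt

/-- A block point `Lz + r`, `0 ≤ r < L`, over a corner `Lz` all of whose coordinates are multiples of `N` (`L ≤ N`) has all coordinates multiples of
`N` only at `r = 0`. [folklore] -/
theorem boxVec_eq_zero_of_dvd {L : ℕ} {N : ℤ} (hLN : (L : ℤ) ≤ N) {y : LSite d} (hy : ∀ i, N ∣ y i) (r : Fin d → Fin L)
    (h : ∀ i, N ∣ (y + boxVec L r) i) : boxVec L r = 0 := by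
  funext i
  have h1 : N ∣ boxVec L r i := by simpa using (dvd_sub (h i) (hy i))
  obtain ⟨h0, hlt⟩ := boxVec_nonneg_lt r i
  exact Int.eq_zero_of_dvd_of_nonneg_of_lt h0 (lt_of_lt_of_le hlt hLN) h1

/-- … and all coordinates congruent to `e_{i₀}` modulo `N` only at `r = e_{i₀}` (`2 ≤ L ≤ N`). [folklore] -/
theorem boxVec_eq_e_of_dvd {L : ℕ} {N : ℤ} (hLN : (L : ℤ) ≤ N) (hN2 : 2 ≤ N) {y : LSite d} (hy : ∀ i, N ∣ y i) (i₀ : Fin d)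
    (r : Fin d → Fin L) (h : ∀ i, N ∣ (y + boxVec L r) i - e i₀ i) : boxVec L r = e i₀ := by
  funext i
  have h1 : N ∣ boxVec L r i - e i₀ i := by
    have := dvd_sub (h i) (hy i)
    rwa [Pi.add_apply, show y i + boxVec L r i - e i₀ i - y i = boxVec L r i - e i₀ i by ring] at this
  obtain ⟨h0, hlt⟩ := boxVec_nonneg_lt r i
  have hltN : boxVec L r i < N := lt_of_lt_of_le hlt hLN
  rw [e_apply] at h1 ⊢
  by_cases hi : i = i₀
  · rw [if_pos hi] at h1 ⊢
    rcases h1 with ⟨c, hc⟩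
    have hc0 : c = 0 := by
      by_contra hne
      rcases lt_or_gt_of_ne hne with hlt' | hgt
      · nlinarith
      · nlinarith
    rw [hc0, mul_zero] at hc
    linarith
  · rw [if_neg hi] at h1 ⊢
    rw [sub_zero] at h1
    exact Int.eq_zero_of_dvd_of_nonneg_of_lt h0 hltN h1

/-- Off the corners `Nℤᵈ`: no point of the block `Lz + [0, L)ᵈ` (with `Lz ∉ Nℤᵈ`, `L ∣ N`, `L ≥ 2`) is congruent to `0` or to `e_{i₀}` modulo `N`.
[folklore] -/
theorem not_special_of_not_dvd {L : ℕ} (hL : 2 ≤ L) {N : ℤ} (hLN : (L : ℤ) ∣ N) (z : LSite d) (hz : ¬ ∀ i, N ∣ ((L : ℤ) • z) i)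
    (i₀ : Fin d) (r : Fin d → Fin L) :
    (¬ ∀ i, N ∣ ((L : ℤ) • z + boxVec L r) i) ∧ (¬ ∀ i, N ∣ ((L : ℤ) • z + boxVec L r) i - e i₀ i) := by
  have hLz : ∀ i, (L : ℤ) ∣ ((L : ℤ) • z) i := fun i => ⟨z i, by simp⟩
  constructor
  · intro h
    apply hz
    intro i
    obtain ⟨h0, hlt⟩ := boxVec_nonneg_lt r i
    have hLb : (L : ℤ) ∣ boxVec L r i := by
      have := dvd_sub (dvd_trans hLN (h i)) (hLz i)
      simpa using this
    have hb : boxVec L r i = 0 := Int.eq_zero_of_dvd_of_nonneg_of_lt h0 hlt hLb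
    have := h i
    rwa [Pi.add_apply, hb, add_zero] at this
  · intro h
    apply hz
    intro i
    obtain ⟨h0, hlt⟩ := boxVec_nonneg_lt r i
    have hLb : (L : ℤ) ∣ boxVec L r i - e i₀ i := by
      have := dvd_sub (dvd_trans hLN (h i)) (hLz i)
      rwa [Pi.add_apply, show ((L : ℤ) • z) i + boxVec L r i - e i₀ i - ((L : ℤ) • z) i = boxVec L r i - e i₀ i by ring] at this
    -- `b_i − δ_{i i₀} ∈ [−1, L − 1)` is a multiple of `L ≥ 2`, hence `0`
    have hb : boxVec L r i = e i₀ i := by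
      rw [e_apply] at hLb ⊢
      rcases hLb with ⟨c, hc⟩
      have hL2 : (2 : ℤ) ≤ (L : ℤ) := by exact_mod_cast hL
      have hc0 : c = 0 := by
        by_contra hne
        rcases lt_or_gt_of_ne hne with hlt' | hgt
        · have : (L : ℤ) * c ≤ -(L : ℤ) := by nlinarith
          split_ifs at hc <;> linarith
        · have : (L : ℤ) ≤ (L : ℤ) * c := by nlinarith
          split_ifs at hc <;> linarith
      rw [hc0, mul_zero] at hc
      linarith
    have := h i
    rwa [Pi.add_apply, hb, add_sub_cancel_right] at this

variable {𝔸 : Type*} [NormedRing 𝔸] [NormedAlgebra ℂ 𝔸] [CompleteSpace 𝔸]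

/-- **THE ONE-STEP AVERAGE (78) OF THE TWO-POINT BUMP IS TRIVIAL AT EVERY BLOCK.**  Let `w` equal `e^{X}` on `Nℤᵈ`, `e^{−X}` on `e_{i₀} + Nℤᵈ` and `1`
elsewhere (`‖X‖ ≤ 1/8`, `2 ≤ L ≤ N`, `L ∣ N`).  Then `{w(x)}_{x ∈ B(Lz)} = 1` for every block corner `Lz`: on a block over a corner of `Nℤᵈ` the
exponents `log(w(Lz)⁻¹w(x))` are `0` (at the corner), `−2X` (at the neighbour) and `−X` (at the other `Lᵈ − 2` points), summing to `−LᵈX`, so the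
average is `e^{X}e^{−X} = 1`; on every other block `w ≡ 1`. [cite: Balaban1985Averaging, (78) p.30] -/
theorem savg_bump_eq_one {L : ℕ} (hL : 2 ≤ L) {N : ℤ} (hLN : (L : ℤ) ∣ N) (hLN' : (L : ℤ) ≤ N) (i₀ : Fin d)
    {X : 𝔸} (hX : ‖X‖ ≤ 1 / 8) {w : LSite d → 𝔸ˣ}
    (hw0 : ∀ x, (∀ i, N ∣ x i) → w x = expUnit X)
    (hw1 : ∀ x, (∀ i, N ∣ x i - e i₀ i) → w x = (expUnit X)⁻¹)
    (hw2 : ∀ x, (¬ ∀ i, N ∣ x i) → (¬ ∀ i, N ∣ x i - e i₀ i) → w x = 1) (z : LSite d) :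
    savg L w ((L : ℤ) • z) = 1 := by
  letI : NormedAlgebra ℚ 𝔸 := NormedAlgebra.restrictScalars ℚ ℂ 𝔸
  have hN2 : (2 : ℤ) ≤ N := le_trans (by exact_mod_cast hL) hLN'
  have hmX : mlog (exp (-X)) = -X :=
    B7BlockAvgLog.mlog_exp (by rw [norm_neg]; linarith [Real.log_two_gt_d9])
  have hm2X : mlog (exp (-X + -X)) = -X + -X :=
    B7BlockAvgLog.mlog_exp (by have := norm_add_le (-X) (-X); rw [norm_neg] at this; linarith [Real.log_two_gt_d9])
  set y : LSite d := (L : ℤ) • z with hy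
  by_cases hcase : ∀ i, N ∣ y i
  · -- the block over a corner of `Nℤᵈ`
    set r0 : Fin d → Fin L := fun _ => ⟨0, by omega⟩ with hr0def
    set r₁ : Fin d → Fin L := fun i => if i = i₀ then ⟨1, by omega⟩ else ⟨0, by omega⟩ with hr₁def
    have hb0 : boxVec L r0 = 0 := by funext i; simp [boxVec, hr0def]
    have hb1 : boxVec L r₁ = e i₀ := by
      funext i; simp only [boxVec, hr₁def, e_apply]; split_ifs <;> simp
    have hr₁ne : r₁ ≠ r0 := by
      intro h; have := congrFun h i₀; simp [hr₁def, hr0def] at this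
    have hwy : w y = expUnit X := hw0 y hcase
    have hwy1 : w (y + e i₀) = (expUnit X)⁻¹ := hw1 _ (fun i => by rw [Pi.add_apply, add_sub_cancel_right]; exact hcase i)
    -- the summand of `Sexp`
    have hterm : ∀ r : Fin d → Fin L, mlog ((((w y)⁻¹ * w (y + boxVec L r) : 𝔸ˣ)) : 𝔸) =
        -X + ((if r = r0 then X else 0) + (if r = r₁ then -X else 0)) := by
      intro r
      by_cases h0 : r = r0
      · rw [if_pos h0, if_neg (h0 ▸ hr₁ne.symm |> fun h => h ∘ Eq.symm |> fun h' => by exact fun e => h' e.symm), h0, hb0, add_zero,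
          inv_mul_cancel, Units.val_one, mlog_one]
        abel
      · rw [if_neg h0]
        by_cases h1 : r = r₁
        · rw [if_pos h1, h1, hb1, hwy, hwy1, val_inv_expUnit, Units.val_mul, val_expUnit,
            ← exp_add_of_commute (Commute.refl (-X)), hm2X]
          abel
        · rw [if_neg h1, add_zero, add_zero, hwy]
          have hn0 : ¬ ∀ i, N ∣ (y + boxVec L r) i := fun h =>
            h0 (boxVec_injective L ((boxVec_eq_zero_of_dvd hLN' hcase r h).trans hb0.symm))
          have hn1 : ¬ ∀ i, N ∣ (y + boxVec L r) i - e i₀ i := fun h =>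
            h1 (boxVec_injective L ((boxVec_eq_e_of_dvd hLN' hN2 hcase i₀ r h).trans hb1.symm))
          rw [hw2 _ hn0 hn1, mul_one, val_inv_expUnit, val_expUnit, hmX]
    -- the sum
    have hcard : (Finset.univ : Finset (Fin d → Fin L)).card = L ^ d := by
      rw [Finset.card_univ, Fintype.card_fun, Fintype.card_fin, Fintype.card_fin]
    have hLd : ((L : ℝ) ^ d) ≠ 0 := by positivity
    have hS : Sexp L w y = -X := by
      rw [Sexp_apply]
      simp_rw [hterm, smul_add, Finset.sum_add_distrib, smul_ite, smul_zero, Finset.sum_ite_eq', Finset.mem_univ, if_true,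
        Finset.sum_const, hcard, ← Nat.cast_smul_eq_nsmul ℝ, smul_smul]
      push_cast
      rw [mul_inv_cancel₀ hLd, one_smul, smul_neg]
      abel
    rw [savg_apply, hS, hwy, ← val_inv_expUnit, mul_inv_cancel]
  · -- any other block: `w ≡ 1` on it
    have hwy : w y = 1 := hw2 y hcase (fun h => hcase (fun i => by
      exfalso
      have h1 : (L : ℤ) ∣ y i₀ - 1 := by simpa [e_apply] using dvd_trans hLN (h i₀)
      have h2 : (L : ℤ) ∣ y i₀ := ⟨z i₀, by simp [hy]⟩
      have h3 : (L : ℤ) ∣ 1 := by simpa using dvd_sub h2 h1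
      have : (L : ℤ) ≤ 1 := Int.le_of_dvd one_pos h3
      have : (2 : ℤ) ≤ L := by exact_mod_cast hL
      linarith))
    have hS : Sexp L w y = 0 := by
      rw [Sexp_apply]
      refine Finset.sum_eq_zero fun r _ => ?_
      obtain ⟨hn0, hn1⟩ := not_special_of_not_dvd hL hLN z hcase i₀ r
      rw [hwy, hw2 _ hn0 hn1, inv_one, one_mul, Units.val_one, mlog_one, smul_zero]
    rw [savg_apply, hS, hwy, one_mul]
    exact Units.ext (by rw [val_expUnit, NormedSpace.exp_zero, Units.val_one])

/-- … hence ALL the iterated averages (79)–(80) of the bump relative to the trivial background are `1` from level `1` on.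
[cite: Balaban1985Averaging, (79)–(80) p.30] -/
theorem uavg_bump_eq_one {L : ℕ} (hL : 2 ≤ L) {N : ℤ} (hLN : (L : ℤ) ∣ N) (hLN' : (L : ℤ) ≤ N) (i₀ : Fin d)
    {X : 𝔸} (hX : ‖X‖ ≤ 1 / 8) {w : LSite d → 𝔸ˣ}
    (hw0 : ∀ x, (∀ i, N ∣ x i) → w x = expUnit X)
    (hw1 : ∀ x, (∀ i, N ∣ x i - e i₀ i) → w x = (expUnit X)⁻¹)
    (hw2 : ∀ x, (¬ ∀ i, N ∣ x i) → (¬ ∀ i, N ∣ x i - e i₀ i) → w x = 1) :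
    ∀ j : ℕ, 1 ≤ j → uavg L (1 : LSite d → Fin d → 𝔸ˣ) w j = 1
  | 0, h => absurd h (by norm_num)
  | 1, _ => by
    funext z
    rw [uavg_succ_one_left, uavg_zero]
    exact savg_bump_eq_one hL hLN hLN' i₀ hX hw0 hw1 hw2 z
  | j + 2, _ => by
    funext z
    rw [uavg_succ_one_left, uavg_bump_eq_one hL hLN hLN' i₀ hX hw0 hw1 hw2 (j + 1) (by omega)]
    exact savg_const L 1 _

end Bump

end Summit.QuantumFields.YangMills.Theorems.Prop7Orbit16UnsatZd

end
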